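import Summits.AtomisticToContinuum.Crystallization.Theorems.FreeSplittingCertificatesStrictSplittingRuleCoreFirstOrderDesignGeometry
import Literature.MathematicalPhysics.StatisticalMechanics.TwoScaleShellSums

/-!
# `StrictSplittingRule` (stmt-AtomisticToContinuum-12560): far tail sums of the hcp site map

Route `FreeSplittingCertificates`, crux r3 `StrictSplittingRule`, line `registered` (unit b2b-freesplit-B, gen 4).
The far field of the joint certificate H12⋆ (`CoreJointCoercive`, …CoreJointDefs.lean) is built from
`(1+r)⁻⁶`-decaying tables; every analytic far-field estimate (payments of an `r⁻⁶` import family, tails of the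
line-truss readout form, the exterior bare form) ends in a LATTICE TAIL SUM `Σ_{‖y_d‖ ≥ ρ} ‖y_d‖⁻ⁿ`, `n ≥ 6`, over the
hcp site map `y = hcpSite a h : ℤ³ → ℝ³`.  This file records the brick, for every `ρ ≥ min a h`:

* `hcpSite_sub_norm_ge` — distinct sites are `≥ min a h` apart (covariance `h1_sub_eq` + `h1_norm_ge`; injectivity of the
  site map is the tree's `PricedHcpWindowsIdealStarRigidity.hcpSite_injective`, re-derived inline where needed);
* `hcpSite_finset_tail_inv_pow_six_le` — every FINITE family of sites at distance `≥ ρ` from the root has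
  `Σ ‖y_d‖⁻⁶ ≤ 250 (min a h)⁻³ ρ⁻³` (the tree's two-scale shell sum `sum_inv_pow_six_le_two_scale`);
* `hcpSite_tsum_tail_inv_pow_six_le` — hence the full lattice tail `Σ'_{‖y_d‖ ≥ ρ} ‖y_d‖⁻⁶ ≤ 250 (min a h)⁻³ ρ⁻³`
  (summable by `h1_summable_inv_pow`);
* `hcpSite_tsum_tail_inv_pow_le` — and `Σ'_{‖y_d‖ ≥ ρ} ‖y_d‖⁻ⁿ ≤ 250 (min a h)⁻³ ρ³⁻ⁿ` for every `n ≥ 6`.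

Structural bookkeeping ([folklore]); nothing here is summit progress.
-/

noncomputable section

namespace Summit.AtomisticToContinuum.Crystallization.Theorems.StrictSplittingRuleBirth

open scoped BigOperators Classical
open Literature.MathematicalPhysics.StatisticalMechanics
open Literature.Geometry.DiscreteGeometry
open Summit.AtomisticToContinuum.Crystallization.Theorems.PalmUnimodularRigidity.LayeredLawsSelectHcp
  (hcpSite hcpSite_zero)

/-- **Distinct hcp sites are `≥ min a h` apart** (`a, h > 0`): `y_d − y_{d'}` is `± y_{±(d − d')}` by Bravais
covariance, and every site other than the root is at distance `≥ min a h` from it. [folklore] -/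
theorem hcpSite_sub_norm_ge {a h : ℝ} (ha : 0 < a) (hh : 0 < h) {d d' : ℤ × ℤ × ℤ} (hne : d ≠ d') :
    min a h ≤ ‖hcpSite a h d - hcpSite a h d'‖ := by
  have e := h1_sub_eq a h d' (d - d')
  rw [add_sub_cancel] at e
  rw [e]
  have hd : d - d' ≠ 0 := sub_ne_zero.2 hne
  split_ifs with hev
  · exact h1_norm_ge ha hh hd
  · rw [norm_neg]
    exact h1_norm_ge ha hh (neg_ne_zero.2 hd)

/-- **Finite far tail.**  For `a, h > 0`, `ρ ≥ min a h` and any finite family `D` of indices whose sites are at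
distance `≥ ρ` from the root, `Σ_{d ∈ D} ‖y_d‖⁻⁶ ≤ 250 (min a h)⁻³ ρ⁻³` (two-scale shell sum about the root,
the sites being `min a h`-separated). [folklore] -/
theorem hcpSite_finset_tail_inv_pow_six_le {a h : ℝ} (ha : 0 < a) (hh : 0 < h) {ρ : ℝ} (hρ : min a h ≤ ρ)
    (D : Finset (ℤ × ℤ × ℤ)) (hD : ∀ d ∈ D, ρ ≤ ‖hcpSite a h d‖) :
    ∑ d ∈ D, ‖hcpSite a h d‖⁻¹ ^ 6 ≤ 250 * (min a h)⁻¹ ^ 3 * ρ⁻¹ ^ 3 := by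
  have hη : 0 < min a h := lt_min ha hh
  -- the site map is injective (the tree's `PricedHcpWindowsIdealStarRigidity.hcpSite_injective`; re-derived inline from the separation)
  have hinj : ∀ d d' : ℤ × ℤ × ℤ, hcpSite a h d = hcpSite a h d' → d = d' := by
    intro d d' hdd
    by_contra hne
    have := hcpSite_sub_norm_ge ha hh hne
    rw [hdd, sub_self, norm_zero] at this
    exact absurd this (not_le.2 hη)
  set t : Finset (EuclideanSpace ℝ (Fin 3)) := D.image (hcpSite a h) with ht
  have hsum : ∑ d ∈ D, ‖hcpSite a h d‖⁻¹ ^ 6 = ∑ z ∈ t, (dist (0 : EuclideanSpace ℝ (Fin 3)) z)⁻¹ ^ 6 := by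
    rw [ht, Finset.sum_image fun d _ d' _ hdd => hinj d d' hdd]
    refine Finset.sum_congr rfl fun d _ => ?_
    rw [dist_comm, dist_zero_right]
  rw [hsum]
  refine sum_inv_pow_six_le_two_scale t 0 hη hρ ?_ ?_
  · intro z hz w hw hzw
    obtain ⟨d, -, rfl⟩ := Finset.mem_image.1 hz
    obtain ⟨d', -, rfl⟩ := Finset.mem_image.1 hw
    rw [dist_eq_norm]
    exact hcpSite_sub_norm_ge ha hh fun hdd => hzw (hdd ▸ rfl)
  · intro z hz
    obtain ⟨d, hd, rfl⟩ := Finset.mem_image.1 hz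
    rw [dist_comm, dist_zero_right]
    exact hD d hd

/-- **Lattice far tail, power six.**  For `a, h > 0` and `ρ ≥ min a h`:
`Σ'_{d : ‖y_d‖ ≥ ρ} ‖y_d‖⁻⁶ ≤ 250 (min a h)⁻³ ρ⁻³`. [folklore] -/
theorem hcpSite_tsum_tail_inv_pow_six_le {a h : ℝ} (ha : 0 < a) (hh : 0 < h) {ρ : ℝ} (hρ : min a h ≤ ρ) :
    Summable (fun d : ℤ × ℤ × ℤ => if ρ ≤ ‖hcpSite a h d‖ then ‖hcpSite a h d‖⁻¹ ^ 6 else 0) ∧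
    ∑' d : ℤ × ℤ × ℤ, (if ρ ≤ ‖hcpSite a h d‖ then ‖hcpSite a h d‖⁻¹ ^ 6 else 0) ≤
      250 * (min a h)⁻¹ ^ 3 * ρ⁻¹ ^ 3 := by
  have hnn : ∀ d : ℤ × ℤ × ℤ, 0 ≤ (if ρ ≤ ‖hcpSite a h d‖ then ‖hcpSite a h d‖⁻¹ ^ 6 else 0) := by
    intro d; split_ifs <;> positivity
  have hbd : ∀ D : Finset (ℤ × ℤ × ℤ),
      ∑ d ∈ D, (if ρ ≤ ‖hcpSite a h d‖ then ‖hcpSite a h d‖⁻¹ ^ 6 else 0) ≤ 250 * (min a h)⁻¹ ^ 3 * ρ⁻¹ ^ 3 := by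
    intro D
    rw [← Finset.sum_filter]
    exact hcpSite_finset_tail_inv_pow_six_le ha hh hρ _ fun d hd => (Finset.mem_filter.1 hd).2
  exact ⟨summable_of_sum_le hnn hbd, Real.tsum_le_of_sum_le hnn hbd⟩

/-- **Lattice far tail, power `n ≥ 6`.**  For `a, h > 0`, `ρ ≥ min a h` and `6 ≤ n`:
`Σ'_{d : ‖y_d‖ ≥ ρ} ‖y_d‖⁻ⁿ ≤ 250 (min a h)⁻³ ρ⁻¹ ^ (n − 3)` — each term is `≤ ρ⁻⁽ⁿ⁻⁶⁾ ‖y_d‖⁻⁶`. [folklore] -/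
theorem hcpSite_tsum_tail_inv_pow_le {a h : ℝ} (ha : 0 < a) (hh : 0 < h) {ρ : ℝ} (hρ : min a h ≤ ρ)
    {n : ℕ} (hn : 6 ≤ n) :
    Summable (fun d : ℤ × ℤ × ℤ => if ρ ≤ ‖hcpSite a h d‖ then ‖hcpSite a h d‖⁻¹ ^ n else 0) ∧
    ∑' d : ℤ × ℤ × ℤ, (if ρ ≤ ‖hcpSite a h d‖ then ‖hcpSite a h d‖⁻¹ ^ n else 0) ≤
      250 * (min a h)⁻¹ ^ 3 * ρ⁻¹ ^ (n - 3) := by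
  have hρ0 : 0 < ρ := lt_of_lt_of_le (lt_min ha hh) hρ
  obtain ⟨hs6, ht6⟩ := hcpSite_tsum_tail_inv_pow_six_le ha hh hρ
  -- termwise domination by ρ⁻⁽ⁿ⁻⁶⁾ times the power-six summand
  set f6 := fun d : ℤ × ℤ × ℤ => if ρ ≤ ‖hcpSite a h d‖ then ‖hcpSite a h d‖⁻¹ ^ 6 else 0 with hf6
  set fn := fun d : ℤ × ℤ × ℤ => if ρ ≤ ‖hcpSite a h d‖ then ‖hcpSite a h d‖⁻¹ ^ n else 0 with hfn
  have hnn : ∀ d, 0 ≤ fn d := by intro d; simp only [hfn]; split_ifs <;> positivity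
  have hdom : ∀ d, fn d ≤ ρ⁻¹ ^ (n - 6) * f6 d := by
    intro d
    simp only [hfn, hf6]
    split_ifs with hd
    · have hy : 0 < ‖hcpSite a h d‖ := lt_of_lt_of_le hρ0 hd
      have h1 : ‖hcpSite a h d‖⁻¹ ≤ ρ⁻¹ := (inv_le_inv₀ hy hρ0).2 hd
      have h2 : ‖hcpSite a h d‖⁻¹ ^ (n - 6) ≤ ρ⁻¹ ^ (n - 6) :=
        pow_le_pow_left₀ (inv_nonneg.2 hy.le) h1 _
      calc ‖hcpSite a h d‖⁻¹ ^ n = ‖hcpSite a h d‖⁻¹ ^ (n - 6) * ‖hcpSite a h d‖⁻¹ ^ 6 := by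
            rw [← pow_add, Nat.sub_add_cancel hn]
        _ ≤ ρ⁻¹ ^ (n - 6) * ‖hcpSite a h d‖⁻¹ ^ 6 :=
            mul_le_mul_of_nonneg_right h2 (by positivity)
    · simp
  have hsn : Summable fn := (hs6.mul_left (ρ⁻¹ ^ (n - 6))).of_nonneg_of_le hnn hdom
  refine ⟨hsn, ?_⟩
  calc ∑' d, fn d ≤ ∑' d, ρ⁻¹ ^ (n - 6) * f6 d := hsn.tsum_le_tsum hdom (hs6.mul_left _)
    _ = ρ⁻¹ ^ (n - 6) * ∑' d, f6 d := tsum_mul_left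
    _ ≤ ρ⁻¹ ^ (n - 6) * (250 * (min a h)⁻¹ ^ 3 * ρ⁻¹ ^ 3) :=
        mul_le_mul_of_nonneg_left ht6 (by positivity)
    _ = 250 * (min a h)⁻¹ ^ 3 * ρ⁻¹ ^ (n - 3) := by
        have : n - 3 = (n - 6) + 3 := by omega
        rw [this, pow_add]; ring

end Summit.AtomisticToContinuum.Crystallization.Theorems.StrictSplittingRuleBirth

end
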